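import Literature.Topology.FourManifolds.SmoothOrientationSphereProofs
import Literature.Topology.FourManifolds.SmoothOrientationConnectedProofs
import Literature.Topology.FourManifolds.SmoothOrientationDiffeomorphProofs
import Mathlib.Analysis.Normed.Module.Connected
import HarnessLib

/-!
# Orientation-preserving diffeomorphisms of `𝕊ⁿ` and the outward-normal frame determinant

Topic `Literature/Topology/FourManifolds`; a proved bridge between the tree's abstract notion of
orientation preservation, `Diffeomorph.IsOrientationPreserving o o f` for a smooth orientation
`o : Literature.Topology.FourManifolds.SmoothOrientation (𝓡 n) 𝕊ⁿ` (an orientation of the model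
space at every point, read in Mathlib's preferred stereographic chart there, whose Jacobian signs
are uncontrolled), and the classical criterion for the round sphere
`𝕊ⁿ = Metric.sphere (0 : EuclideanSpace ℝ (Fin (n + 1))) 1 ⊂ ℝⁿ⁺¹` with its **standard
orientation as the boundary of the disc** ("outward normal first", Hirsch, *Differential Topology*
(1976), Ch. 4 §4, p. 101 and Ch. 5 §1, p. 115): a frame `(v₁, …, vₙ)` of `T_x 𝕊ⁿ = x^⊥` is
positive iff `det[x, v₁, …, vₙ] > 0`.

* `Literature.Topology.FourManifolds.Diffeomorph.isOrientationPreserving_sphere_iff_frameDet_mul_pos`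
  — for `n ≠ 0`, EVERY smooth orientation `o` of `𝕊ⁿ` and every self-diffeomorphism `f`:
  `f` preserves `o` iff at every `z`
  `det[f z, d(ι ∘ f)_z e₁, …, d(ι ∘ f)_z eₙ] · det[z, dι_z e₁, …, dι_z eₙ] > 0`,
  where `ι : 𝕊ⁿ → ℝⁿ⁺¹` is the inclusion, `d` is Mathlib's `mfderiv` and `e₁, …, eₙ` is the
  standard basis of the model space `EuclideanSpace ℝ (Fin n)` (the chart basis at `z`); i.e. iff
  `df_z` carries the chart frame at `z` to a frame at `f z` of the same orientation character
  relative to the outward normals — `f` preserves the standard orientation of `𝕊ⁿ = ∂Dⁿ⁺¹`.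
  (`𝕊ⁿ` being connected for `n ≠ 0`, `o` is `±` the standard orientation
  `exists_smoothOrientation_sphere`, `SmoothOrientation.eq_or_eq_neg_of_connectedSpace_holds`,
  and preserving `o` is the same as preserving `-o`.)

Ingredients, all from the tree (`SmoothOrientationSphereProofs.lean`): the frame determinant
`det[x, dι_x e₁, …, dι_x eₙ] ≠ 0` (`basisFun_det_cons_ne_zero`), its description of the standard
orientation (`exists_smoothOrientation_sphere`, `mfderiv_coe_sphere_eq_fderiv`), and the scaling
`det[p, A T e₁, …] = det T · det[p, A e₁, …]` (`det_cons_comp_eq_det_mul`) applied to the chain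
rule `d(ι ∘ f)_z = dι_{f z} ∘ df_z`; `Diffeomorph.det_mfderiv_ne_zero` and the sign rule
`mul_pos_iff_pos_iff_pos` (`SmoothOrientationDiffeomorphProofs.lean`).

Consumer: `Literature/Geometry/Symplectic/ContactIsotopySphereThreeProofs.lean` (Geiges' Lemma
4.11.1 on `S³`: the hypothesis "`f` orientation preserving" of Eliashberg's contact representative,
in the classical form needed to know that `Tf(ξ_st)` is a *positive* contact structure).

## References

* M. W. Hirsch, *Differential Topology*, GTM 33, Springer (1976), Ch. 4 §4, p. 101 (orientation of
  `Sⁿ = ∂Dⁿ⁺¹`; `L ∈ O(n+1)` preserves it iff `det L > 0`), Ch. 5 §1, p. 115. [HirschDT1976]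
-/

open scoped Manifold ContDiff Topology
open Set Module Metric Function

noncomputable section

namespace Literature.Topology.FourManifolds

open SmoothOrientation.Sphere

variable {n : ℕ}

/-- Propositional bookkeeping: `((A ↔ B) ↔ C) ↔ ((C ↔ A) ↔ B)`. [folklore] -/
theorem iff_iff_iff_rotate {A B C : Prop} : ((A ↔ B) ↔ C) ↔ ((C ↔ A) ↔ B) := by
  tauto

/-- **The outward-normal frame determinant of `𝕊ⁿ` never vanishes**:
`det[x, dι_x e₁, …, dι_x eₙ] ≠ 0` for the differential `dι_x = mfderiv val x` of the inclusion
`𝕊ⁿ → ℝⁿ⁺¹` read in the chart at `x` (it is injective with range `x^⊥ ∌ x`; tree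
`basisFun_det_cons_ne_zero`, Mathlib `mfderiv_coe_sphere_injective`, `range_mfderiv_coe_sphere`).
[folklore] -/
theorem basisFun_det_cons_mfderiv_coe_ne_zero (x : sphere (0 : EuclideanSpace ℝ (Fin (n + 1))) 1) :
    (EuclideanSpace.basisFun (Fin (n + 1)) ℝ).toBasis.det
      (Fin.cons (x : EuclideanSpace ℝ (Fin (n + 1))) fun i =>
        (mfderiv (𝓡 n) 𝓘(ℝ, EuclideanSpace ℝ (Fin (n + 1)))
          (Subtype.val : sphere (0 : EuclideanSpace ℝ (Fin (n + 1))) 1 → EuclideanSpace ℝ (Fin (n + 1)))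
          x : EuclideanSpace ℝ (Fin n) →L[ℝ] EuclideanSpace ℝ (Fin (n + 1)))
          ((EuclideanSpace.basisFun (Fin n) ℝ).toBasis i)) ≠ 0 := by
  haveI : Fact (finrank ℝ (EuclideanSpace ℝ (Fin (n + 1))) = n + 1) := ⟨finrank_euclideanSpace_fin⟩
  exact basisFun_det_cons_ne_zero x _
    (mfderiv_coe_sphere_injective (E := EuclideanSpace ℝ (Fin (n + 1))) (n := n) x)
    (range_mfderiv_coe_sphere (E := EuclideanSpace ℝ (Fin (n + 1))) (n := n) x)

/-- The standard orientation of `𝕊ⁿ` (`exists_smoothOrientation_sphere`) read through the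
differential of the inclusion: its value at `x` is the standard orientation of the model space iff
`det[x, dι_x e₁, …, dι_x eₙ] > 0` (`mfderiv_coe_sphere_eq_fderiv`).
[cite: HirschDT1976, §4.4 p. 101 and §5.1 p. 115] -/
theorem exists_smoothOrientation_sphere_mfderiv (n : ℕ) :
    ∃ o : SmoothOrientation (𝓡 n) (sphere (0 : EuclideanSpace ℝ (Fin (n + 1))) 1),
      ∀ x : sphere (0 : EuclideanSpace ℝ (Fin (n + 1))) 1, o x =
        if 0 < (EuclideanSpace.basisFun (Fin (n + 1)) ℝ).toBasis.det
            (Fin.cons (x : EuclideanSpace ℝ (Fin (n + 1))) fun i =>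
              (mfderiv (𝓡 n) 𝓘(ℝ, EuclideanSpace ℝ (Fin (n + 1)))
                (Subtype.val : sphere (0 : EuclideanSpace ℝ (Fin (n + 1))) 1 →
                  EuclideanSpace ℝ (Fin (n + 1))) x :
                EuclideanSpace ℝ (Fin n) →L[ℝ] EuclideanSpace ℝ (Fin (n + 1)))
                ((EuclideanSpace.basisFun (Fin n) ℝ).toBasis i))
        then euclideanOrientation n else -euclideanOrientation n := by
  obtain ⟨o, ho⟩ := exists_smoothOrientation_sphere n
  refine ⟨o, fun x => ?_⟩
  rw [ho x, ← mfderiv_coe_sphere_eq_fderiv x]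
  rfl

/-- **Orientation-preserving self-diffeomorphisms of `𝕊ⁿ` via the outward-normal frame
determinant** (Hirsch, *Differential Topology*, Ch. 4 §4, p. 101: `Sⁿ` oriented as `∂Dⁿ⁺¹`, a
frame `(v₁, …, vₙ)` at `x` being positive iff `det[x, v₁, …, vₙ] > 0`). For `n ≠ 0`, any smooth
orientation `o` of `𝕊ⁿ` and any self-diffeomorphism `f`, `f` preserves `o` iff for every `z`
`det[f z, d(ι ∘ f)_z e₁, …, d(ι ∘ f)_z eₙ] · det[z, dι_z e₁, …, dι_z eₙ] > 0`
(`ι` the inclusion into `ℝⁿ⁺¹`, `e` the standard basis of the model space, differentials =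
Mathlib's `mfderiv` in the chart at `z`): the image under `df_z` of the chart frame at `z` has, at
`f z`, the orientation character of that frame at `z`, both measured against the outward normals.
Proof: `o = ± o_std` on the connected `𝕊ⁿ` (`eq_or_eq_neg_of_connectedSpace_holds`,
`exists_smoothOrientation_sphere`), `o_std x = ±std` according to the sign of the frame
determinant at `x`, and `det[f z, dι_{fz} df_z e] = det(df_z) · det[f z, dι_{fz} e]`
(`det_cons_comp_eq_det_mul`). [cite: HirschDT1976, §4.4 p. 101] -/
theorem Diffeomorph.isOrientationPreserving_sphere_iff_frameDet_mul_pos (hn : n ≠ 0)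
    (o : SmoothOrientation (𝓡 n) (sphere (0 : EuclideanSpace ℝ (Fin (n + 1))) 1))
    (f : (sphere (0 : EuclideanSpace ℝ (Fin (n + 1))) 1) ≃ₘ⟮𝓡 n, 𝓡 n⟯
      (sphere (0 : EuclideanSpace ℝ (Fin (n + 1))) 1)) :
    f.IsOrientationPreserving o o ↔
      ∀ z : sphere (0 : EuclideanSpace ℝ (Fin (n + 1))) 1,
        0 < (EuclideanSpace.basisFun (Fin (n + 1)) ℝ).toBasis.det
              (Fin.cons ((f z : sphere (0 : EuclideanSpace ℝ (Fin (n + 1))) 1) :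
                  EuclideanSpace ℝ (Fin (n + 1))) fun i =>
                (mfderiv (𝓡 n) 𝓘(ℝ, EuclideanSpace ℝ (Fin (n + 1)))
                  (Subtype.val ∘ f) z :
                  EuclideanSpace ℝ (Fin n) →L[ℝ] EuclideanSpace ℝ (Fin (n + 1)))
                  ((EuclideanSpace.basisFun (Fin n) ℝ).toBasis i)) *
            (EuclideanSpace.basisFun (Fin (n + 1)) ℝ).toBasis.det
              (Fin.cons (z : EuclideanSpace ℝ (Fin (n + 1))) fun i =>
                (mfderiv (𝓡 n) 𝓘(ℝ, EuclideanSpace ℝ (Fin (n + 1)))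
                  (Subtype.val : sphere (0 : EuclideanSpace ℝ (Fin (n + 1))) 1 →
                    EuclideanSpace ℝ (Fin (n + 1))) z :
                  EuclideanSpace ℝ (Fin n) →L[ℝ] EuclideanSpace ℝ (Fin (n + 1)))
                  ((EuclideanSpace.basisFun (Fin n) ℝ).toBasis i)) := by
  haveI : Fact (finrank ℝ (EuclideanSpace ℝ (Fin (n + 1))) = n + 1) := ⟨finrank_euclideanSpace_fin⟩
  haveI : ConnectedSpace (sphere (0 : EuclideanSpace ℝ (Fin (n + 1))) 1) := by
    refine isConnected_iff_connectedSpace.mp (isConnected_sphere ?_ 0 zero_le_one)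
    rw [← Module.finrank_eq_rank, finrank_euclideanSpace_fin]
    exact_mod_cast (by omega : 1 < n + 1)
  obtain ⟨o₀, ho₀⟩ := exists_smoothOrientation_sphere_mfderiv n
  -- reduce to the standard orientation `o₀` (`o = ± o₀`)
  have hred : f.IsOrientationPreserving o o ↔ f.IsOrientationPreserving o₀ o₀ := by
    rcases SmoothOrientation.eq_or_eq_neg_of_connectedSpace_holds o₀ o with h | h
    · rw [h]
    · rw [h]
      exact isOrientationPreserving_neg_neg_iff o₀ o₀ f
  rw [hred]
  refine forall_congr' fun z => ?_
  -- the two frame determinants of the statement and the one at `f z`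
  set D : ℝ := (EuclideanSpace.basisFun (Fin (n + 1)) ℝ).toBasis.det
      (Fin.cons ((f z : sphere (0 : EuclideanSpace ℝ (Fin (n + 1))) 1) :
          EuclideanSpace ℝ (Fin (n + 1))) fun i =>
        (mfderiv (𝓡 n) 𝓘(ℝ, EuclideanSpace ℝ (Fin (n + 1))) (Subtype.val ∘ f) z :
          EuclideanSpace ℝ (Fin n) →L[ℝ] EuclideanSpace ℝ (Fin (n + 1)))
          ((EuclideanSpace.basisFun (Fin n) ℝ).toBasis i)) with hD
  set P : ℝ := (EuclideanSpace.basisFun (Fin (n + 1)) ℝ).toBasis.det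
      (Fin.cons (z : EuclideanSpace ℝ (Fin (n + 1))) fun i =>
        (mfderiv (𝓡 n) 𝓘(ℝ, EuclideanSpace ℝ (Fin (n + 1)))
          (Subtype.val : sphere (0 : EuclideanSpace ℝ (Fin (n + 1))) 1 →
            EuclideanSpace ℝ (Fin (n + 1))) z :
          EuclideanSpace ℝ (Fin n) →L[ℝ] EuclideanSpace ℝ (Fin (n + 1)))
          ((EuclideanSpace.basisFun (Fin n) ℝ).toBasis i)) with hP
  set Q : ℝ := (EuclideanSpace.basisFun (Fin (n + 1)) ℝ).toBasis.det
      (Fin.cons ((f z : sphere (0 : EuclideanSpace ℝ (Fin (n + 1))) 1) :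
          EuclideanSpace ℝ (Fin (n + 1))) fun i =>
        (mfderiv (𝓡 n) 𝓘(ℝ, EuclideanSpace ℝ (Fin (n + 1)))
          (Subtype.val : sphere (0 : EuclideanSpace ℝ (Fin (n + 1))) 1 →
            EuclideanSpace ℝ (Fin (n + 1))) (f z) :
          EuclideanSpace ℝ (Fin n) →L[ℝ] EuclideanSpace ℝ (Fin (n + 1)))
          ((EuclideanSpace.basisFun (Fin n) ℝ).toBasis i)) with hQ
  have hP0 : P ≠ 0 := basisFun_det_cons_mfderiv_coe_ne_zero z
  have hQ0 : Q ≠ 0 := basisFun_det_cons_mfderiv_coe_ne_zero (f z)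
  -- the Jacobian determinant `d = det (df_z)` of the diffeomorphism, nonzero
  set d : ℝ := LinearMap.det (M := EuclideanSpace ℝ (Fin n))
    (mfderiv (𝓡 n) (𝓡 n) f z).toLinearMap with hd
  have hd0 : d ≠ 0 := f.det_mfderiv_ne_zero (by simp) z
  -- chain rule `d(ι ∘ f)_z = dι_{f z} ∘ df_z` and the scaling of the frame determinant
  have hchain : mfderiv (𝓡 n) 𝓘(ℝ, EuclideanSpace ℝ (Fin (n + 1))) (Subtype.val ∘ f) z =
      (mfderiv (𝓡 n) 𝓘(ℝ, EuclideanSpace ℝ (Fin (n + 1)))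
        (Subtype.val : sphere (0 : EuclideanSpace ℝ (Fin (n + 1))) 1 →
          EuclideanSpace ℝ (Fin (n + 1))) (f z)).comp (mfderiv (𝓡 n) (𝓡 n) f z) :=
    mfderiv_comp z ((contMDiff_coe_sphere (m := ∞)).mdifferentiableAt (by simp))
      (f.contMDiff.mdifferentiableAt (by simp))
  have hDQ : D = d * Q := by
    rw [hD, hchain]
    exact det_cons_comp_eq_det_mul (EuclideanSpace.basisFun (Fin (n + 1)) ℝ).toBasis
      (EuclideanSpace.basisFun (Fin n) ℝ).toBasis _ _ _
  -- unfold orientation preservation at `z` for the standard orientation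
  show (o₀ (f z) = o₀ z ↔ 0 < d) ↔ 0 < D * P
  rw [ho₀ (f z), ho₀ z, ite_neg_eq_ite_neg_iff (Module.Ray.ne_neg_self _), hDQ,
    mul_pos_iff_pos_iff_pos (mul_ne_zero hd0 hQ0) hP0, mul_pos_iff_pos_iff_pos hd0 hQ0]
  exact iff_iff_iff_rotate

end Literature.Topology.FourManifolds

end
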